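import Literature.NumberTheory.LFunctions.ConreyIwaniec2002KernelMellin
import HarnessLib

/-!
# Conrey–Iwaniec (2002), Theorem 6.1, (6.7)–(6.10): the elementary bounds for `L(T log(1+h/n))`

B. Conrey, H. Iwaniec, Acta Arith. 103 (2002) 259–312, §6 [held text `paper:arxiv-math_0111012`,
p0014:L77–L120]: "we use the approximation `log(m/n) = log(1+h/n) = h/n + O(h²/n²)` to modify
`L(T log(m/n))` as follows `L(T log(m/n)) = L(hT/n) + O(T⁻¹(1+hT/n)⁻²)` … (6.7)–(6.8) … We may
estimate `S*(h)` trivially … `≤ 2(hT)⁻²G₂` (6.10)."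

PROVED HERE (namespace `ConreyIwaniec2002.Thm61GenericPart`; second of four files towards the
registered sub-stub S2a `stub_thm61_generic` of SKELETON P64, line `thm61-cm-convolution`), for an
admissible kernel `K` (`|L^{(j)}(v)| ≤ (1+|v|)⁻⁴`, `j ≤ 5`) and `T > 0`, with explicit constants:
* `sum_range_inv_one_add_mul_sq_le`, `tsum_inv_one_add_mul_sq_le`: `Σ_{k≥1}(1+kx)⁻² ≤ 1/x`
  (telescoping), the row sum behind (6.7) `𝒜′(T) ≪ T⁻¹G₁`;
* `sum_range_indicator_inv_sq_le`, `tsum_indicator_inv_sq_le`: `Σ_{k>H} k⁻² ≤ 1/H` (telescoping),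
  behind (6.12);
* `abs_ciL_log_sub_le` — **(6.7)–(6.8)**: `|L(T log(1+x)) − L(Tx)| ≤ 16T⁻¹(1+Tx)⁻²` for `0 < x ≤ 1`
  (mean value theorem, `|L′| ≤ (1+v)⁻⁴` on `v ≥ Tx/2`, `x/2 ≤ x/(1+x) ≤ log(1+x) ≤ x`);
* `abs_ciL_diff_le`: for `h, n ≥ 1`,
  `|L(T log((n+h)/n)) − 𝟙_{h≤H}L(hT/n)| ≤ 16T⁻¹(1+hT/n)⁻² + 32T⁻⁴ + 𝟙_{h>H}·4n²/(hT)²`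
  ((6.7)–(6.8) for `h ≤ min(n, H)`; (6.10) in the form `|L(T log(1+h/n))| ≤ 4n²/(hT)²` for
  `H < h ≤ n`; and `|L| ≤ (1+T log 2)⁻⁴ ≤ 16T⁻⁴` for the terms `n < h`, which the source absorbs
  into `T⁻³Y^{9/4}` at (6.31)).

«The programme SEARCHES and TYPES; no claim about Landau–Siegel zeros, Theorems 1–2 of
arXiv:2211.02515 or a repaired Margin232 until a kernel theorem says so.»

## References
* [ConreyIwaniec2002] B. Conrey, H. Iwaniec, *Spacing of zeros of Hecke L-functions and the class
  number problem*, Acta Arith. 103 (2002) 259–312, arXiv:math/0111012: §5 (5.14)–(5.18), §6 (6.1)–(6.12).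
-/

noncomputable section

open Complex MeasureTheory Set Filter Real Finset
open scoped ComplexConjugate

namespace Literature.NumberTheory.LFunctions

namespace ConreyIwaniec2002

namespace Thm61GenericPart

open KernelMellin (abs_ciL_le)

/-! ### Two telescoping sums -/

/-- `Σ_{k ≥ 1} (1 + kx)⁻² ≤ 1/x` for `x > 0` (telescoping against `1/((1+(k−1)x)(1+kx))`);
partial sums. [cite: ConreyIwaniec2002, §6 (6.7)] -/
theorem sum_range_inv_one_add_mul_sq_le {x : ℝ} (hx : 0 < x) (N : ℕ) :
    ∑ k ∈ Finset.range N, ((1 + (k + 1) * x) ^ 2)⁻¹ ≤ (1 - (1 + N * x)⁻¹) / x := by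
  induction N with
  | zero => simp
  | succ N ih =>
    rw [Finset.sum_range_succ]
    have hN : (0:ℝ) ≤ N := Nat.cast_nonneg N
    have h1 : 0 < 1 + (N : ℝ) * x := by positivity
    have h2 : 0 < 1 + ((N : ℝ) + 1) * x := by positivity
    have hstep : ((1 + ((N : ℝ) + 1) * x) ^ 2)⁻¹ ≤
        ((1 + N * x)⁻¹ - (1 + ((N : ℝ) + 1) * x)⁻¹) / x := by
      rw [div_eq_mul_inv, ← sub_nonneg]
      have : ((1 + N * x)⁻¹ - (1 + ((N : ℝ) + 1) * x)⁻¹) * x⁻¹ - ((1 + ((N : ℝ) + 1) * x) ^ 2)⁻¹ =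
          x * ((1 + N * x) * (1 + ((N : ℝ) + 1) * x) ^ 2)⁻¹ := by
        field_simp
        ring
      rw [this]
      positivity
    push_cast
    calc ∑ k ∈ Finset.range N, ((1 + ((k : ℝ) + 1) * x) ^ 2)⁻¹ + ((1 + ((N : ℝ) + 1) * x) ^ 2)⁻¹
        ≤ (1 - (1 + N * x)⁻¹) / x + ((1 + N * x)⁻¹ - (1 + ((N : ℝ) + 1) * x)⁻¹) / x :=
          add_le_add ih hstep
      _ = (1 - (1 + ((N : ℝ) + 1) * x)⁻¹) / x := by ring

/-- `Σ_{k ≥ 1} (1 + kx)⁻² ≤ 1/x` for `x > 0`, as a summable `tsum` over `k − 1 ∈ ℕ`.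
[cite: ConreyIwaniec2002, §6 (6.7)] -/
theorem tsum_inv_one_add_mul_sq_le {x : ℝ} (hx : 0 < x) :
    Summable (fun k : ℕ => ((1 + ((k : ℝ) + 1) * x) ^ 2)⁻¹) ∧
      ∑' k : ℕ, ((1 + ((k : ℝ) + 1) * x) ^ 2)⁻¹ ≤ x⁻¹ := by
  have hnn : ∀ k : ℕ, 0 ≤ ((1 + ((k : ℝ) + 1) * x) ^ 2)⁻¹ := fun k => by positivity
  have hbd : ∀ N : ℕ, ∑ k ∈ Finset.range N, ((1 + ((k : ℝ) + 1) * x) ^ 2)⁻¹ ≤ x⁻¹ := by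
    intro N
    refine (sum_range_inv_one_add_mul_sq_le hx N).trans ?_
    rw [div_eq_mul_inv]
    have : 0 ≤ (1 + (N : ℝ) * x)⁻¹ := by positivity
    nlinarith [inv_pos.mpr hx]
  exact ⟨summable_of_sum_range_le hnn hbd, Real.tsum_le_of_sum_range_le hnn hbd⟩

/-- `Σ_{k > H} k⁻² ≤ 1/H` (`H ≥ 1`; telescoping against `1/(k(k−1))`); partial sums in the form
`Σ_{k < N, k+1 > H} (k+1)⁻² ≤ 1/H − 1/max(H,N)`. [cite: ConreyIwaniec2002, §6 (6.10)–(6.12)] -/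
theorem sum_range_indicator_inv_sq_le {H : ℕ} (hH : 1 ≤ H) (N : ℕ) :
    ∑ k ∈ Finset.range N, (if H < k + 1 then (((k : ℝ) + 1) ^ 2)⁻¹ else 0) ≤
      (H : ℝ)⁻¹ - ((max H N : ℕ) : ℝ)⁻¹ := by
  induction N with
  | zero => simp
  | succ N ih =>
    rw [Finset.sum_range_succ]
    by_cases hNH : H < N + 1
    · rw [if_pos hNH]
      have hHN : H ≤ N := by omega
      have hmax1 : max H N = N := max_eq_right hHN
      have hmax2 : max H (N + 1) = N + 1 := max_eq_right (by omega)
      rw [hmax1] at ih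
      rw [hmax2]
      have hN1 : (1:ℝ) ≤ N := by exact_mod_cast (le_trans hH hHN)
      have hstep : (((N : ℝ) + 1) ^ 2)⁻¹ ≤ (N : ℝ)⁻¹ - ((N : ℝ) + 1)⁻¹ := by
        rw [← sub_nonneg]
        have : (N : ℝ)⁻¹ - ((N : ℝ) + 1)⁻¹ - (((N : ℝ) + 1) ^ 2)⁻¹ =
            (N * ((N : ℝ) + 1) ^ 2)⁻¹ := by
          field_simp
          ring
        rw [this]
        positivity
      push_cast
      linarith
    · rw [if_neg hNH, add_zero]
      have hmax1 : max H N = H := max_eq_left (by omega)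
      have hmax2 : max H (N + 1) = H := max_eq_left (by omega)
      rw [hmax1] at ih
      rw [hmax2]
      exact ih

/-- `Σ_{k > H} k⁻² ≤ 1/H` (`H ≥ 1`) as a `tsum` over `k − 1 ∈ ℕ` with an indicator.
[cite: ConreyIwaniec2002, §6 (6.10)–(6.12)] -/
theorem tsum_indicator_inv_sq_le {H : ℕ} (hH : 1 ≤ H) :
    Summable (fun k : ℕ => if H < k + 1 then (((k : ℝ) + 1) ^ 2)⁻¹ else 0) ∧
      ∑' k : ℕ, (if H < k + 1 then (((k : ℝ) + 1) ^ 2)⁻¹ else 0) ≤ (H : ℝ)⁻¹ := by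
  have hnn : ∀ k : ℕ, 0 ≤ (if H < k + 1 then (((k : ℝ) + 1) ^ 2)⁻¹ else 0) := fun k => by
    split_ifs <;> positivity
  have hbd : ∀ N : ℕ, ∑ k ∈ Finset.range N, (if H < k + 1 then (((k : ℝ) + 1) ^ 2)⁻¹ else 0) ≤
      (H : ℝ)⁻¹ := fun N =>
    (sum_range_indicator_inv_sq_le hH N).trans (sub_le_self _ (by positivity))
  exact ⟨summable_of_sum_range_le hnn hbd, Real.tsum_le_of_sum_range_le hnn hbd⟩

/-! ### The pointwise bounds for `L(T log(1+h/n))` ((6.7)–(6.8), (6.10)) -/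

section Kernel

variable {K : ℝ → ℝ} (hK : IsCIKernel K) {T : ℝ} (hT : 0 < T)
include hK hT

/-- `|L(v)| ≤ (1+|v|)⁻⁴ ≤ 16/T⁴` once `v ≥ T/2`. [cite: ConreyIwaniec2002, §6 (6.3)] -/
theorem abs_ciL_le_of_half_le {v : ℝ} (hv : T / 2 ≤ v) : |ciL K v| ≤ 16 * (T ^ 4)⁻¹ := by
  refine (abs_ciL_le hK v).trans ?_
  rw [abs_of_nonneg (by linarith), show (16 : ℝ) * (T ^ 4)⁻¹ = ((T / 2) ^ 4)⁻¹ by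
    rw [div_pow]; field_simp; norm_num]
  exact inv_anti₀ (by positivity) (pow_le_pow_left₀ (by linarith) (by linarith) 4)

/-- **(6.7)–(6.8)**: for `0 < x ≤ 1`, `|L(T log(1+x)) − L(Tx)| ≤ 16 T⁻¹ (1+Tx)⁻²` (mean value
theorem with `|L′| ≤ (1+v)⁻⁴` on `v ≥ Tx/2`, `x/2 ≤ x/(1+x) ≤ log(1+x) ≤ x`).
[cite: ConreyIwaniec2002, §6 (6.7)–(6.8)] -/
theorem abs_ciL_log_sub_le {x : ℝ} (hx : 0 < x) (hx1 : x ≤ 1) :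
    |ciL K (T * Real.log (1 + x)) - ciL K (T * x)| ≤ 16 * T⁻¹ * ((1 + T * x) ^ 2)⁻¹ := by
  have hlog_le : Real.log (1 + x) ≤ x := by
    have := Real.log_le_sub_one_of_pos (by linarith : 0 < 1 + x); linarith
  have hlog_ge : x / 2 ≤ Real.log (1 + x) := by
    have h1 := Real.one_sub_inv_le_log_of_pos (by linarith : 0 < 1 + x)
    have h2 : x / 2 ≤ 1 - (1 + x)⁻¹ := by
      rw [show 1 - (1 + x)⁻¹ = x / (1 + x) by field_simp; ring]
      exact div_le_div_of_nonneg_left hx.le (by linarith) (by linarith)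
    linarith
  have hlog_ge' : x - x ^ 2 ≤ Real.log (1 + x) := by
    have h1 := Real.one_sub_inv_le_log_of_pos (by linarith : 0 < 1 + x)
    have h2 : x - x ^ 2 ≤ 1 - (1 + x)⁻¹ := by
      rw [show 1 - (1 + x)⁻¹ = x / (1 + x) by field_simp; ring, le_div_iff₀ (by linarith)]
      nlinarith
    linarith
  -- mean value theorem on `[Tx/2, ∞)`
  set C : ℝ := ((1 + T * x / 2) ^ 4)⁻¹ with hC
  have hdiff : ∀ v ∈ Set.Ici (T * x / 2), DifferentiableAt ℝ (ciL K) v := fun v _ =>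
    (hK.2.2.2.2.1.differentiable (by norm_num)).differentiableAt
  have hbound : ∀ v ∈ Set.Ici (T * x / 2), ‖deriv (ciL K) v‖ ≤ C := by
    intro v hv
    have hv0 : 0 ≤ v := le_trans (by positivity) hv
    have h := hK.2.2.2.2.2 1 (by norm_num) v
    rw [iteratedDeriv_one, abs_of_nonneg hv0] at h
    rw [Real.norm_eq_abs]
    refine h.trans (inv_anti₀ (by positivity) ?_)
    exact pow_le_pow_left₀ (by positivity) (by linarith [Set.mem_Ici.mp hv]) 4
  have hmvt := (convex_Ici (T * x / 2)).norm_image_sub_le_of_norm_deriv_le hdiff hbound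
    (show T * x ∈ Set.Ici (T * x / 2) from Set.mem_Ici.mpr (by nlinarith))
    (show T * Real.log (1 + x) ∈ Set.Ici (T * x / 2) from Set.mem_Ici.mpr (by nlinarith))
  rw [Real.norm_eq_abs, Real.norm_eq_abs] at hmvt
  have hdist : |T * Real.log (1 + x) - T * x| ≤ T * x ^ 2 := by
    rw [abs_sub_comm, abs_of_nonneg (by nlinarith)]
    nlinarith
  have hTx : 0 ≤ T * x := by positivity
  calc |ciL K (T * Real.log (1 + x)) - ciL K (T * x)|
      ≤ C * |T * Real.log (1 + x) - T * x| := hmvt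
    _ ≤ C * (T * x ^ 2) := mul_le_mul_of_nonneg_left hdist (by positivity)
    _ ≤ 16 * T⁻¹ * ((1 + T * x) ^ 2)⁻¹ := by
        rw [hC]
        rw [show ((1 + T * x / 2) ^ 4)⁻¹ * (T * x ^ 2) = T * x ^ 2 / (1 + T * x / 2) ^ 4 by
            field_simp,
          show (16 : ℝ) * T⁻¹ * ((1 + T * x) ^ 2)⁻¹ = 16 / (T * (1 + T * x) ^ 2) by
            rw [div_eq_mul_inv, mul_inv, mul_assoc],
          div_le_div_iff₀ (by positivity) (by positivity)]
        -- `T x² · T (1+Tx)² ≤ 16 (1+Tx/2)⁴ = (2+Tx)⁴`, with `u = Tx`: `u²(1+u)² ≤ (2+u)⁴`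
        have key : (T * x) ^ 2 * (1 + T * x) ^ 2 ≤ (2 + T * x) ^ 4 := by
          have h1 : (T * x) * (1 + T * x) ≤ (2 + T * x) ^ 2 := by nlinarith
          calc (T * x) ^ 2 * (1 + T * x) ^ 2 = ((T * x) * (1 + T * x)) ^ 2 := by ring
            _ ≤ ((2 + T * x) ^ 2) ^ 2 := pow_le_pow_left₀ (by positivity) h1 2
            _ = (2 + T * x) ^ 4 := by ring
        calc T * x ^ 2 * (T * (1 + T * x) ^ 2) = (T * x) ^ 2 * (1 + T * x) ^ 2 := by ring
          _ ≤ (2 + T * x) ^ 4 := key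
          _ = 16 * (1 + T * x / 2) ^ 4 := by ring

/-- The three cases together: for `h, n ≥ 1`,
`|L(T log((n+h)/n)) − 𝟙_{h ≤ H} L(hT/n)| ≤ 16T⁻¹(1+hT/n)⁻² + 32T⁻⁴ + 𝟙_{h > H}·4n²/(hT)²`
((6.7)–(6.8) for `h ≤ n`, `h ≤ H`; (6.10) `|L(T log(1+h/n))| ≤ 4n²/(hT)²` for `H < h ≤ n`;
`|L| ≤ (1 + T log 2)⁻⁴ ≤ 16T⁻⁴` for the terms `n < h`).
[cite: ConreyIwaniec2002, §6 (6.7)–(6.10)] -/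
theorem abs_ciL_diff_le (H : ℕ) {h n : ℕ} (hh : 1 ≤ h) (hn : 1 ≤ n) :
    |ciL K (T * (Real.log (↑(n + h)) - Real.log n)) -
        (if h ≤ H then ciL K (h * T / n) else 0)| ≤
      16 * T⁻¹ * ((1 + h * T / n) ^ 2)⁻¹ + 32 * (T ^ 4)⁻¹ +
        (if H < h then 4 * (n : ℝ) ^ 2 / ((h : ℝ) * T) ^ 2 else 0) := by
  have hn0 : (0:ℝ) < n := by exact_mod_cast hn
  have hh0 : (0:ℝ) < h := by exact_mod_cast hh
  set x : ℝ := h / n with hx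
  have hx0 : 0 < x := by positivity
  have hlog : Real.log (↑(n + h)) - Real.log n = Real.log (1 + x) := by
    rw [← Real.log_div (by positivity) hn0.ne']
    congr 1
    push_cast
    rw [hx]; field_simp
  have hxT : h * T / n = T * x := by rw [hx]; ring
  rw [hlog, hxT]
  have hA : 0 ≤ 16 * T⁻¹ * ((1 + T * x) ^ 2)⁻¹ := by positivity
  have hB : 0 ≤ 32 * (T ^ 4)⁻¹ := by positivity
  have hCnn : 0 ≤ (if H < h then 4 * (n : ℝ) ^ 2 / ((h : ℝ) * T) ^ 2 else 0) := by
    split_ifs <;> positivity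
  -- `log(1+x) ≥ x/2` when `x ≤ 1`, `≥ log 2` when `x ≥ 1`
  have hlog_lb : ∀ {y : ℝ}, 0 < y → y ≤ 1 → y / 2 ≤ Real.log (1 + y) := by
    intro y hy hy1
    have h1 := Real.one_sub_inv_le_log_of_pos (by linarith : 0 < 1 + y)
    have h2 : y / 2 ≤ 1 - (1 + y)⁻¹ := by
      rw [show 1 - (1 + y)⁻¹ = y / (1 + y) by field_simp; ring]
      exact div_le_div_of_nonneg_left hy.le (by linarith) (by linarith)
    linarith
  rcases le_or_gt h n with hhn | hnh
  · -- `h ≤ n`: `x ≤ 1`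
    have hx1 : x ≤ 1 := by rw [hx, div_le_one hn0]; exact_mod_cast hhn
    by_cases hhH : h ≤ H
    · rw [if_pos hhH, if_neg (not_lt.mpr hhH), add_zero]
      exact (abs_ciL_log_sub_le hK hT hx0 hx1).trans (le_add_of_nonneg_right hB)
    · rw [if_neg hhH, if_pos (not_le.mp hhH), sub_zero]
      -- (6.10): `|L(T log(1+x))| ≤ (T x/2)⁻² = 4 n²/(hT)²`
      have hv : T * x / 2 ≤ T * Real.log (1 + x) := by nlinarith [hlog_lb hx0 hx1]
      have hTx2 : 0 < T * x / 2 := by positivity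
      have h1 : |ciL K (T * Real.log (1 + x))| ≤ 4 * (n : ℝ) ^ 2 / ((h : ℝ) * T) ^ 2 := by
        refine (abs_ciL_le hK _).trans ?_
        rw [abs_of_nonneg (hTx2.le.trans hv)]
        calc ((1 + T * Real.log (1 + x)) ^ 4)⁻¹ ≤ ((T * x / 2) ^ 2)⁻¹ := by
              refine inv_anti₀ (by positivity) ?_
              calc (T * x / 2) ^ 2 ≤ (1 + T * Real.log (1 + x)) ^ 2 :=
                    pow_le_pow_left₀ hTx2.le (by linarith) 2
                _ ≤ (1 + T * Real.log (1 + x)) ^ 4 :=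
                    pow_le_pow_right₀ (by linarith) (by norm_num)
          _ = 4 * (n : ℝ) ^ 2 / ((h : ℝ) * T) ^ 2 := by rw [hx]; field_simp; ring
      linarith
  · -- `n < h`: both values are `≤ 16 T⁻⁴`
    have hx1 : 1 ≤ x := by
      rw [hx, le_div_iff₀ hn0, one_mul]; exact_mod_cast hnh.le
    have hv1 : T / 2 ≤ T * Real.log (1 + x) := by
      have : (1:ℝ) / 2 ≤ Real.log (1 + x) :=
        le_trans (hlog_lb one_pos le_rfl) (Real.log_le_log (by norm_num) (by linarith))
      nlinarith
    have hv2 : T / 2 ≤ T * x := by nlinarith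
    have h1 := abs_ciL_le_of_half_le hK hT hv1
    have h2 := abs_ciL_le_of_half_le hK hT hv2
    by_cases hhH : h ≤ H
    · rw [if_pos hhH]
      calc |ciL K (T * Real.log (1 + x)) - ciL K (T * x)|
          ≤ |ciL K (T * Real.log (1 + x))| + |ciL K (T * x)| := abs_sub _ _
        _ ≤ 16 * (T ^ 4)⁻¹ + 16 * (T ^ 4)⁻¹ := add_le_add h1 h2
        _ = 32 * (T ^ 4)⁻¹ := by ring
        _ ≤ _ := by linarith
    · rw [if_neg hhH, sub_zero]
      linarith

end Kernel

end Thm61GenericPart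

end ConreyIwaniec2002

end Literature.NumberTheory.LFunctions

end
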